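import Summits.Ventures.Crystal3D.Theorems.StickyWulffConstantNoReconstructionGainOffLattice
import Literature.Algebra.EuclideanLattices.FccBccLattices
import HarnessLib

/-!
# Cap rigidity on a `(111)` face: the first rungs of the slot-ledger line `WallLedgerG`
# (crux `GenericWallFloor`, stmt-Ventures-19480)

HONEST FRAMING. Part of the venture `Summits/Ventures/Crystal3D` (cell `crystal3d-full`), route
`route-Ventures-StickyWulffConstant`.  Elementary rungs typed by planner crystal3d-full-p1 (gen 16,
`HOME/cf-p1/route/lines/wall/WallLedgerRungs.lean`, memo ROUTE.md §68) for the slot-ledger reading of the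
crux stub `stub_twoSlabAdhesion`; this file PROVES all four (`rung_capSum`, `rung_offLatticeMoved` were
already proved by the planner and are carried verbatim; `rung_hexCap`, `rung_saturationRegistry111` are
new proofs).

SATURATION ⇒ REGISTRY on a `(111)` face.  Frame: the face is `e₃`-normal, the in-plane nearest
neighbours of a face site are the hexagon `(±1,0,0), (±½, ±√3/2, 0)`.  A ball touching the face site from
the free side has direction `u`, `‖u‖ = 1`, `u₂ ≥ 0`, at angular distance `≥ 60°` from the six in-plane
neighbours (`|⟪u, e_k⟫| ≤ ½`), i.e. its in-plane part lies in the regular hexagon of inradius `½`, hence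
in the disc of radius `1/√3`:  `rung_hexCap : u₂² ≥ 2/3`.  Three such balls pairwise non-overlapping
(`⟪uᵢ, uⱼ⟫ ≤ ½`) have `u₁₂+u₂₂+u₃₂ ≤ ‖u₁+u₂+u₃‖ ≤ √6` (`rung_capSum`), so all three sit at the cap rim
`uᵢ₂ = √(2/3)` with in-plane parts of length `1/√3` at hexagon VERTICES (`u₀ ∈ {0, ±½}`) and pairwise
inner products exactly `½`: the fcc-slot triple or the twin-slot triple (`rung_saturationRegistry111`).
Consequence used by the ledger (memo §68 (R)): a `(111)`-face ball of a clamped grain whose 9 grain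
neighbours are present is SATURATED (12 contacts) only by three balls in exact fcc or twin registry.
`rung_offLatticeMoved` is the landed `fcc_offLattice_unitContacts_le_three` (L3′) transported to a moved
lattice `A·Λ₀ + t`.

WHAT THIS IS NOT: any statement about the crux stub `stub_twoSlabAdhesion` itself; rung F-C1 not moved.
-/

noncomputable section

namespace Summit.Ventures.Crystal3D.Theorems

open Real
open Literature.Algebra.EuclideanLattices (norm_sq_fin_three)
open scoped InnerProductSpace

/-- `y² + yz + z² ≤ 1/4` on the hexagon `|y|, |z|, |y + z| ≤ ½` (tight at the six vertices, so no
degree-2 certificate: sign split of `y, z, y + z`). -/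
theorem hexagon_quadratic_le (y z : ℝ) (hy : |y| ≤ 1 / 2) (hz : |z| ≤ 1 / 2) (hyz : |y + z| ≤ 1 / 2) :
    y ^ 2 + y * z + z ^ 2 ≤ 1 / 4 := by
  obtain ⟨hy1, hy2⟩ := abs_le.1 hy
  obtain ⟨hz1, hz2⟩ := abs_le.1 hz
  obtain ⟨hs1, hs2⟩ := abs_le.1 hyz
  have hy2' : y ^ 2 ≤ 1 / 4 := by nlinarith
  have hz2' : z ^ 2 ≤ 1 / 4 := by nlinarith
  have hs2' : (y + z) ^ 2 ≤ 1 / 4 := by nlinarith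
  rcases le_total 0 y with h0y | hy0 <;> rcases le_total 0 z with h0z | hz0
  · nlinarith [mul_nonneg h0y h0z]
  · rcases le_total 0 (y + z) with h0s | hs0
    · nlinarith [mul_nonpos_iff.2 (Or.inr ⟨hz0, h0s⟩)]
    · nlinarith [mul_nonpos_iff.2 (Or.inl ⟨h0y, hs0⟩)]
  · rcases le_total 0 (y + z) with h0s | hs0
    · nlinarith [mul_nonpos_iff.2 (Or.inr ⟨hy0, h0s⟩)]
    · nlinarith [mul_nonpos_iff.2 (Or.inl ⟨h0z, hs0⟩)]
  · nlinarith [mul_nonneg_of_nonpos_of_nonpos hy0 hz0]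

/-- Equality case of `hexagon_quadratic_le`: `y² + yz + z² = 1/4` on the hexagon forces
`y + z ∈ {0, ±½}` (a hexagon vertex). -/
theorem hexagon_quadratic_eq (y z : ℝ) (hy : |y| ≤ 1 / 2) (hz : |z| ≤ 1 / 2) (hyz : |y + z| ≤ 1 / 2)
    (heq : y ^ 2 + y * z + z ^ 2 = 1 / 4) :
    y + z = 0 ∨ y + z = 1 / 2 ∨ y + z = -(1 / 2) := by
  obtain ⟨hy1, hy2⟩ := abs_le.1 hy
  obtain ⟨hz1, hz2⟩ := abs_le.1 hz
  obtain ⟨hs1, hs2⟩ := abs_le.1 hyz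
  have hy2' : y ^ 2 ≤ 1 / 4 := by nlinarith
  have hz2' : z ^ 2 ≤ 1 / 4 := by nlinarith
  have hs2' : (y + z) ^ 2 ≤ 1 / 4 := by nlinarith
  -- in every sign case `(y + z) · (2(y+z) − 1) · (2(y+z) + 1) = 0`
  have key : (y + z) * (2 * (y + z) - 1) * (2 * (y + z) + 1) = 0 := by
    rcases le_total 0 y with h0y | hy0 <;> rcases le_total 0 z with h0z | hz0
    · have h : (y + z) ^ 2 = 1 / 4 := by nlinarith [mul_nonneg h0y h0z]
      linear_combination (4 * (y + z)) * h
    · rcases le_total 0 (y + z) with h0s | hs0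
      · have h : z * (y + z) = 0 := by nlinarith [mul_nonpos_iff.2 (Or.inr ⟨hz0, h0s⟩)]
        rcases mul_eq_zero.1 h with h' | h'
        · have h'' : y ^ 2 = 1 / 4 := by rw [h'] at heq; nlinarith
          rw [h']; linear_combination (4 * y) * h''
        · rw [h']; ring
      · have h : y * (y + z) = 0 := by nlinarith [mul_nonpos_iff.2 (Or.inl ⟨h0y, hs0⟩)]
        rcases mul_eq_zero.1 h with h' | h'
        · have h'' : z ^ 2 = 1 / 4 := by rw [h'] at heq; nlinarith
          rw [h']; linear_combination (4 * z) * h''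
        · rw [h']; ring
    · rcases le_total 0 (y + z) with h0s | hs0
      · have h : y * (y + z) = 0 := by nlinarith [mul_nonpos_iff.2 (Or.inr ⟨hy0, h0s⟩)]
        rcases mul_eq_zero.1 h with h' | h'
        · have h'' : z ^ 2 = 1 / 4 := by rw [h'] at heq; nlinarith
          rw [h']; linear_combination (4 * z) * h''
        · rw [h']; ring
      · have h : z * (y + z) = 0 := by nlinarith [mul_nonpos_iff.2 (Or.inl ⟨h0z, hs0⟩)]
        rcases mul_eq_zero.1 h with h' | h'
        · have h'' : y ^ 2 = 1 / 4 := by rw [h'] at heq; nlinarith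
          rw [h']; linear_combination (4 * y) * h''
        · rw [h']; ring
    · have h : (y + z) ^ 2 = 1 / 4 := by nlinarith [mul_nonneg_of_nonpos_of_nonpos hy0 hz0]
      linear_combination (4 * (y + z)) * h
  rcases mul_eq_zero.1 key with h | h
  · rcases mul_eq_zero.1 h with h | h
    · exact Or.inl h
    · exact Or.inr (Or.inl (by linarith))
  · exact Or.inr (Or.inr (by linarith))

/-- **rung_hexCap** (S): a unit vector at angular distance `≥ 60°` from the six hexagon directions
`(±1,0,0), (±½,±√3/2,0)` has `u₂² ≥ 2/3` (in-plane part in the hexagon of inradius ½ ⊆ disc of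
radius 1/√3).  With `y = u₀/2 + (√3/2) u₁`, `z = u₀/2 − (√3/2) u₁`:
`u₀² + u₁² = (4/3)(y² + yz + z²) ≤ 1/3` by `hexagon_quadratic_le`. -/
theorem rung_hexCap (u : EuclideanSpace ℝ (Fin 3)) (hu : ‖u‖ = 1)
    (h₁ : |u 0| ≤ 1 / 2) (h₂ : |u 0 / 2 + Real.sqrt 3 / 2 * u 1| ≤ 1 / 2)
    (h₃ : |u 0 / 2 - Real.sqrt 3 / 2 * u 1| ≤ 1 / 2) :
    2 / 3 ≤ u 2 ^ 2 := by
  have h3 : Real.sqrt 3 ^ 2 = 3 := Real.sq_sqrt (by norm_num)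
  set y : ℝ := u 0 / 2 + Real.sqrt 3 / 2 * u 1 with hy
  set z : ℝ := u 0 / 2 - Real.sqrt 3 / 2 * u 1 with hz
  have hsum : y + z = u 0 := by rw [hy, hz]; ring
  have hq := hexagon_quadratic_le y z h₂ h₃ (by rw [hsum]; exact h₁)
  have hid : u 0 ^ 2 + u 1 ^ 2 = 4 / 3 * (y ^ 2 + y * z + z ^ 2) := by
    rw [hy, hz]; ring_nf; rw [h3]; ring
  have hn := norm_sq_fin_three u
  rw [hu, one_pow] at hn
  nlinarith

/-- **rung_capSum** (S): three unit vectors pairwise at angular distance `≥ 60°` have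
`⟪u₁ + u₂ + u₃, n⟫ ≤ √6` for every unit `n` (`‖Σ uᵢ‖² = 3 + 2 Σ ⟪uᵢ,uⱼ⟫ ≤ 6`).  (Planner's proof.) -/
theorem rung_capSum (u₁ u₂ u₃ n : EuclideanSpace ℝ (Fin 3)) (h1 : ‖u₁‖ = 1) (h2 : ‖u₂‖ = 1)
    (h3 : ‖u₃‖ = 1) (hn : ‖n‖ = 1) (h12 : ⟪u₁, u₂⟫_ℝ ≤ 1 / 2) (h13 : ⟪u₁, u₃⟫_ℝ ≤ 1 / 2)
    (h23 : ⟪u₂, u₃⟫_ℝ ≤ 1 / 2) :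
    ⟪u₁, n⟫_ℝ + ⟪u₂, n⟫_ℝ + ⟪u₃, n⟫_ℝ ≤ Real.sqrt 6 := by
  have hsum : ⟪u₁, n⟫_ℝ + ⟪u₂, n⟫_ℝ + ⟪u₃, n⟫_ℝ = ⟪u₁ + u₂ + u₃, n⟫_ℝ := by
    rw [inner_add_left, inner_add_left]
  rw [hsum]
  have hle : ⟪u₁ + u₂ + u₃, n⟫_ℝ ≤ ‖u₁ + u₂ + u₃‖ := by
    have := real_inner_le_norm (u₁ + u₂ + u₃) n
    rw [hn, mul_one] at this
    exact this
  have hsq : ‖u₁ + u₂ + u₃‖ ^ 2 ≤ 6 := by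
    have e : ‖u₁ + u₂ + u₃‖ ^ 2 = ‖u₁‖ ^ 2 + ‖u₂‖ ^ 2 + ‖u₃‖ ^ 2 +
        2 * (⟪u₁, u₂⟫_ℝ + ⟪u₁, u₃⟫_ℝ + ⟪u₂, u₃⟫_ℝ) := by
      rw [norm_add_sq_real, norm_add_sq_real, inner_add_left]
      ring
    rw [e, h1, h2, h3]
    nlinarith
  have hnn : 0 ≤ ‖u₁ + u₂ + u₃‖ := norm_nonneg _
  have hroot : ‖u₁ + u₂ + u₃‖ ≤ Real.sqrt 6 := by
    rw [show ‖u₁ + u₂ + u₃‖ = Real.sqrt (‖u₁ + u₂ + u₃‖ ^ 2) by rw [Real.sqrt_sq hnn]]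
    exact Real.sqrt_le_sqrt (by linarith)
  linarith

/-- **rung_saturationRegistry111** (M): three free-side unit directions at a `(111)` face site, each
`≥ 60°` from the six in-plane neighbours and pairwise `≥ 60°` apart, are forced to the cap rim:
`uᵢ₂ = √(2/3)`, in-plane length exactly `1/√3` at a hexagon VERTEX (`u 0 ∈ {0, ±½}`), pairwise inner
products exactly `½` — i.e. `{u₁,u₂,u₃}` is the fcc-slot triple or the twin-slot triple. -/
theorem rung_saturationRegistry111 (u : Fin 3 → EuclideanSpace ℝ (Fin 3))
    (hu : ∀ i, ‖u i‖ = 1) (hup : ∀ i, 0 ≤ u i 2)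
    (hhex : ∀ i, |u i 0| ≤ 1 / 2 ∧ |u i 0 / 2 + Real.sqrt 3 / 2 * u i 1| ≤ 1 / 2 ∧
      |u i 0 / 2 - Real.sqrt 3 / 2 * u i 1| ≤ 1 / 2)
    (hsep : ∀ i j, i ≠ j → ⟪u i, u j⟫_ℝ ≤ 1 / 2) :
    (∀ i, u i 2 = Real.sqrt (2 / 3)) ∧ (∀ i, u i 0 ^ 2 + u i 1 ^ 2 = 1 / 3) ∧
      (∀ i, u i 0 = 0 ∨ u i 0 = 1 / 2 ∨ u i 0 = -(1 / 2)) ∧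
      (∀ i j, i ≠ j → ⟪u i, u j⟫_ℝ = 1 / 2) := by
  set s : ℝ := Real.sqrt (2 / 3) with hs
  have hs0 : 0 ≤ s := Real.sqrt_nonneg _
  have hs2 : s ^ 2 = 2 / 3 := Real.sq_sqrt (by norm_num)
  have h6 : Real.sqrt 6 = 3 * s := by
    rw [show (6 : ℝ) = (3 * s) ^ 2 by nlinarith, Real.sqrt_sq (by positivity)]
  -- each `u i 2 ≥ s` (hexCap)
  have hcap : ∀ i, s ≤ u i 2 := by
    intro i
    obtain ⟨ha, hb, hc⟩ := hhex i
    have h := rung_hexCap (u i) (hu i) ha hb hc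
    calc s = Real.sqrt (2 / 3) := rfl
      _ ≤ Real.sqrt (u i 2 ^ 2) := Real.sqrt_le_sqrt h
      _ = u i 2 := Real.sqrt_sq (hup i)
  -- the sum of the three heights is at most `√6 = 3 s` (capSum with `n = e₃`)
  set e₃ : EuclideanSpace ℝ (Fin 3) := EuclideanSpace.single (2 : Fin 3) (1 : ℝ) with he₃
  have he₃n : ‖e₃‖ = 1 := by rw [he₃, PiLp.norm_single, norm_one]
  have hin : ∀ i, ⟪u i, e₃⟫_ℝ = u i 2 := by
    intro i; rw [he₃, EuclideanSpace.inner_single_right]; simp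
  have h01 : (0 : Fin 3) ≠ 1 := by decide
  have h02 : (0 : Fin 3) ≠ 2 := by decide
  have h12 : (1 : Fin 3) ≠ 2 := by decide
  have hsum := rung_capSum (u 0) (u 1) (u 2) e₃ (hu 0) (hu 1) (hu 2) he₃n (hsep 0 1 h01)
    (hsep 0 2 h02) (hsep 1 2 h12)
  rw [hin, hin, hin, h6] at hsum
  have hc0 := hcap 0; have hc1 := hcap 1; have hc2 := hcap 2
  -- hence every height is exactly `s`
  have hz : ∀ i, u i 2 = s := by
    intro i; fin_cases i
    · show u 0 2 = s; linarith
    · show u 1 2 = s; linarith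
    · show u 2 2 = s; linarith
  -- in-plane lengths
  have hplane : ∀ i, u i 0 ^ 2 + u i 1 ^ 2 = 1 / 3 := by
    intro i
    have hn := norm_sq_fin_three (u i)
    rw [hu i, one_pow, hz i, hs2] at hn
    linarith
  refine ⟨hz, hplane, ?_, ?_⟩
  · -- hexagon vertices
    intro i
    obtain ⟨ha, hb, hc⟩ := hhex i
    have h3 : Real.sqrt 3 ^ 2 = 3 := Real.sq_sqrt (by norm_num)
    set y : ℝ := u i 0 / 2 + Real.sqrt 3 / 2 * u i 1 with hy
    set w : ℝ := u i 0 / 2 - Real.sqrt 3 / 2 * u i 1 with hw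
    have hyw : y + w = u i 0 := by rw [hy, hw]; ring
    have hid : u i 0 ^ 2 + u i 1 ^ 2 = 4 / 3 * (y ^ 2 + y * w + w ^ 2) := by
      rw [hy, hw]; ring_nf; rw [h3]; ring
    have heq : y ^ 2 + y * w + w ^ 2 = 1 / 4 := by
      have := hplane i; rw [hid] at this; linarith
    have := hexagon_quadratic_eq y w hb hc (by rw [hyw]; exact ha) heq
    rwa [hyw] at this
  · -- exact kissing: `‖Σ u‖² ≥ (Σ u i 2)² = 6` forces every pairwise inner product to be `½`
    set v : EuclideanSpace ℝ (Fin 3) := u 0 + u 1 + u 2 with hv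
    have hv2 : v 2 = 3 * s := by
      simp only [hv, PiLp.add_apply, hz]; ring
    have hvn : (3 * s) ^ 2 ≤ ‖v‖ ^ 2 := by
      rw [norm_sq_fin_three v, hv2]; nlinarith [sq_nonneg (v 0), sq_nonneg (v 1)]
    have e : ‖v‖ ^ 2 = ‖u 0‖ ^ 2 + ‖u 1‖ ^ 2 + ‖u 2‖ ^ 2 +
        2 * (⟪u 0, u 1⟫_ℝ + ⟪u 0, u 2⟫_ℝ + ⟪u 1, u 2⟫_ℝ) := by
      rw [hv, norm_add_sq_real, norm_add_sq_real, inner_add_left]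
      ring
    rw [e, hu 0, hu 1, hu 2] at hvn
    have h9 : (3 * s) ^ 2 = 6 := by nlinarith
    rw [h9] at hvn
    have i01 := hsep 0 1 h01; have i02 := hsep 0 2 h02; have i12 := hsep 1 2 h12
    have e01 : ⟪u 0, u 1⟫_ℝ = 1 / 2 := by linarith
    have e02 : ⟪u 0, u 2⟫_ℝ = 1 / 2 := by linarith
    have e12 : ⟪u 1, u 2⟫_ℝ = 1 / 2 := by linarith
    intro i j hij
    fin_cases i <;> fin_cases j
    · exact absurd rfl hij
    · exact e01
    · exact e02
    · rw [real_inner_comm]; exact e01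
    · exact absurd rfl hij
    · exact e12
    · rw [real_inner_comm]; exact e02
    · rw [real_inner_comm]; exact e12
    · exact absurd rfl hij

/-- **rung_offLatticeMoved** (S, transport of `Theorems.fcc_offLattice_unitContacts_le_three`): a
point not on a MOVED fcc lattice `A·Λ₀ + t` is at unit distance from at most three of its points.
(Ledger (L3′) for both grains of a wall cell.  Planner's proof.) -/
theorem rung_offLatticeMoved
    (A : EuclideanSpace ℝ (Fin 3) ≃ₗᵢ[ℝ] EuclideanSpace ℝ (Fin 3)) (t q : EuclideanSpace ℝ (Fin 3))
    (hq : q ∉ (fun p => A p + t) ''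
      Literature.MathematicalPhysics.StatisticalMechanics.fccStacking 1 (Real.sqrt (2 / 3)))
    (S : Finset (EuclideanSpace ℝ (Fin 3)))
    (hS : ∀ s ∈ S, s ∈ (fun p => A p + t) ''
      Literature.MathematicalPhysics.StatisticalMechanics.fccStacking 1 (Real.sqrt (2 / 3)) ∧
      dist q s = 1) :
    S.card ≤ 3 := by
  classical
  set f : EuclideanSpace ℝ (Fin 3) → EuclideanSpace ℝ (Fin 3) := fun s => A.symm (s - t) with hf
  have hfinj : Function.Injective f := by
    intro a b hab
    have h' : a - t = b - t := A.symm.injective hab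
    simpa using h'
  have hcard : (S.image f).card = S.card := Finset.card_image_of_injective _ hfinj
  rw [← hcard]
  refine Summit.Ventures.Crystal3D.Theorems.fcc_offLattice_unitContacts_le_three (f q) ?_
    (S.image f) ?_
  · intro hmem
    apply hq
    exact ⟨f q, hmem, by simp [hf]⟩
  · intro y hy
    obtain ⟨s, hs, rfl⟩ := Finset.mem_image.1 hy
    obtain ⟨hsΛ, hds⟩ := hS s hs
    obtain ⟨p, hp, hps⟩ := hsΛ
    refine ⟨?_, ?_⟩
    · have hfs : f s = p := by
        simp only [hf, ← hps]
        simp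
      rw [hfs]
      exact hp
    · simp only [hf]
      rw [LinearIsometryEquiv.dist_map, dist_sub_right]
      exact hds

end Summit.Ventures.Crystal3D.Theorems

end
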